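import Mathlib
import Summits.ValiantsHypothesis.ValiantsHypothesis.Theses.GrenetZeon
import Summits.ValiantsHypothesis.ValiantsHypothesis.Theorems.GrenetZeonTwoDimCoefficientsDefs
import Summits.ValiantsHypothesis.ValiantsHypothesis.Theorems.GrenetZeonTwoDimCoefficientsDualUnipotentTriangular

/-!
# LINE «wild_portrait» — ONE two-headed portrait line on `DualUnipotentThreeHalves` (val-idea-9 g0, lens NEGATION;
  merge of the heads «wild_unfold» and «wild_mass» per critic val-idea-crit-3 VERDICT #2 price P4: one width account)

Target decl BY NAME: `Summit.ValiantsHypothesis.ValiantsHypothesis.Theses.GrenetZeon.DualUnipotentThreeHalves`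
(stmt-ValiantsHypothesis-24318; bears on stmt-8062 `TwoDimCoefficients ↔ DualUnipotentBound`, p595545).

HONEST FRAMING.  This file is the verbatim union of `Lines/wild_unfold.lean` (v2) and `Lines/wild_mass.lean` (v2) plus the
joint composition.  PROVED here (no sorry): U1 `WildUnfold.unfolding_proof : Unfolding` (time-unfolding by nil-index) and
F1 `WildMass.levelFlat_proof : LevelFlat` (level flatness), i.e. the PORTRAIT of a minimal counterexample to the 3/2 rung:
in every block form of every width-`m` representation, index mass `Σ_u r(lev u) ≥ n^{3/2}/12` AND the diagonal (wild)
constituents carry `≥ n² − 2gn` parameters (sorry-free Theorems-grade copies: `Lines/portrait_unfold.lean`,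
`Lines/portrait_mass.lean`).  OPEN (the two sorries = the two per-specific cruxes, EITHER suffices):
U2 `WildUnfold.stub_cheapIndexMass : CheapIndexMass`, F2 `WildMass.stub_cheapParameterMass : CheapParameterMass`.
Composition `dualUnipotentThreeHalves_of_either : CheapIndexMass ∨ CheapParameterMass → DualUnipotentThreeHalves`
(kernel-checked, axioms standard).  Neither crux carries a per-specific MECHANISM yet (VERDICT #2 P3: no prover plate
recommended on U2/F2); the rung is NOT proved; `VP ≠ VNP` is not moved.
-/

set_option linter.dupNamespace false
set_option autoImplicit false

noncomputable section

namespace Summit.ValiantsHypothesis.ValiantsHypothesis.Cruxes.DualUnipotentThreeHalves.WildUnfold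

open MvPolynomial Matrix
open scoped BigOperators
open Literature.Computability.AlgebraicComplexity
open Summit.ValiantsHypothesis.ValiantsHypothesis.Cruxes.TwoDimCoefficients.DimTwoCases
  (AffMat IsAffine DualUnipotentRepr sq_le_of_trace_pow_mul_strictUpper')
open Summit.ValiantsHypothesis.ValiantsHypothesis.Theses.GrenetZeon (DualUnipotentThreeHalves)

/-! ## Block data of a pencil -/

/-- `N` is block-upper-triangular for the level function `lev`: an entry from row-state `i` to column-state `j`
vanishes unless `lev i ≤ lev j` (paths in `tr(N^d M) = Σ N_{i₀i₁}⋯N_{i_{d−1}i_d}M_{i_d i₀}` never decrease level;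
the spans `V_{≤l} = ⟨e_j : lev j ≤ l⟩` are an `𝓛`-invariant chain). -/
def IsBlockUpper {n m : ℕ} (N : AffMat n m) (lev : Fin m → ℕ) : Prop :=
  ∀ i j : Fin m, lev j < lev i → N i j = 0

/-- The diagonal constituent of level `l`, padded with zeros to an `m × m` polynomial matrix. -/
def diagBlock {n m : ℕ} (N : AffMat n m) (lev : Fin m → ℕ) (l : ℕ) : AffMat n m :=
  fun i j => if lev i = l ∧ lev j = l then N i j else 0

/-- INDEX MASS of block data `(lev, r)`: `Σ_u r(lev u) = Σ_l r_l · d_l` (`d_l` = size of level `l`). -/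
def indexMass {m : ℕ} (lev : Fin m → ℕ) (r : ℕ → ℕ) : ℕ := ∑ u : Fin m, r (lev u)

/-- A nilpotent-pencil representation of `per_n` of width `m` in BLOCK FORM with index data `r`: `N, M` affine,
`per_n = tr(N^{n−1}·M)`, `N` block-upper for `lev`, and the level-`l` constituent has space nil-index `≤ r l`
(`(diagBlock N lev l)^{r l} = 0` as a polynomial matrix, i.e. for every parameter value). -/
def BlockRepr (n m : ℕ) (N M : AffMat n m) (lev : Fin m → ℕ) (r : ℕ → ℕ) : Prop :=
  IsAffine N ∧ IsAffine M ∧ perPoly (Fin n) ℂ = (N ^ (n - 1) * M).trace ∧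
    IsBlockUpper N lev ∧ ∀ l : ℕ, (diagBlock N lev l) ^ (r l) = 0

/-- The TRIANGULARISABLE class of the landed rung: `per_n = tr(N^{n−1}·M)` with `N` strictly upper triangular. -/
def StrictUpperRepr (n m' : ℕ) : Prop :=
  ∃ (N M : AffMat n m'), IsAffine N ∧ IsAffine M ∧ (∀ i j : Fin m', j ≤ i → N i j = 0) ∧
    perPoly (Fin n) ℂ = (N ^ (n - 1) * M).trace

/-! ## The two stubs -/

/-- **U1 — UNFOLDING (per-agnostic; provable, size M).**  Block form with index data `r` unfolds to a strictly
upper triangular trace representation of width `indexMass lev r` computing the SAME trace polynomial, for every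
exponent `d`.  Construction: states `(u, c)` with `c < r(lev u)` ordered by `(lev u, c)`; `N'_{(u,c),(v,c')} = N_{uv}`
if `lev u = lev v ∧ c' = c+1` or `lev u < lev v ∧ c' = 0`, else `0`; `M'_{(v,c'),(u,c)} = M_{vu}·[c = 0]`.  Level
tuples of `N`-paths with a run of `≥ r_l` stays in level `l` sum to `(diagBlock N lev l)^{≥ r_l} = 0`; the others
are in bijection with `N'`-paths, with equal weights. -/
def Unfolding : Prop :=
  ∀ (n m d : ℕ) (N M : AffMat n m) (lev : Fin m → ℕ) (r : ℕ → ℕ),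
    IsAffine N → IsAffine M → IsBlockUpper N lev → (∀ l : ℕ, (diagBlock N lev l) ^ (r l) = 0) →
      ∃ (N' M' : AffMat n (indexMass lev r)), IsAffine N' ∧ IsAffine M' ∧
        (∀ i j : Fin (indexMass lev r), j ≤ i → N' i j = 0) ∧ (N' ^ d * M').trace = (N ^ d * M).trace

/-- **U2 — CHEAP INDEX MASS (the crux of the line; per-specific; the typed obstruction of the negation lens).**
Every unipotent dual representation of `per_n` of width `m` can be replaced by one of the same width admitting a
block form of index mass `≤ C·m`.  Negation = the portrait: a counterexample family needs, in EVERY block form of EVERY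
width-`m` representation, wild constituents with `Σ_l (r_l − 1)·d_l ≫ m` (large nil-index AND non-trivial size). -/
def CheapIndexMass : Prop :=
  ∃ C n₀ : ℕ, ∀ n ≥ n₀, ∀ m : ℕ, DualUnipotentRepr n m →
    ∃ (N M : AffMat n m) (lev : Fin m → ℕ) (r : ℕ → ℕ), BlockRepr n m N M lev r ∧ indexMass lev r ≤ C * m

theorem stub_cheapIndexMass : CheapIndexMass := by
  sorry

/-! ## U1 PROVED — the unfolding identity (generic matrix algebra) and the order-preserving reindexing -/

section UnfoldCore

variable {n m : ℕ}

/-- States of the unfolding: `(u, c)` with `c < r (lev u)`. -/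
abbrev St (lev : Fin m → ℕ) (r : ℕ → ℕ) : Type := Σ u : Fin m, Fin (r (lev u))

section Defs
variable (lev : Fin m → ℕ) (r : ℕ → ℕ)

/-- block-diagonal part -/
def dgPart (N : AffMat n m) : AffMat n m :=
  fun u w => if lev u = lev w then N u w else 0
/-- strictly block-upper part -/
def upPart (N : AffMat n m) : AffMat n m :=
  fun u w => if lev u < lev w then N u w else 0
/-- the unfolded pencil -/
def unfN (N : AffMat n m) : Matrix (St lev r) (St lev r) (MvPolynomial (Fin n × Fin n) ℂ) := fun s t =>
  if (lev s.1 = lev t.1 ∧ (t.2 : ℕ) = (s.2 : ℕ) + 1) ∨ (lev s.1 < lev t.1 ∧ (t.2 : ℕ) = 0) then N s.1 t.1 else 0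
/-- the unfolded read-out matrix -/
def unfM (M : AffMat n m) : Matrix (St lev r) (St lev r) (MvPolynomial (Fin n × Fin n) ℂ) := fun t s =>
  if (s.2 : ℕ) = 0 then M t.1 s.1 else 0
variable (n) in
/-- selector of copy `c` -/
def esel (c : ℕ) : Matrix (Fin m) (St lev r) (MvPolynomial (Fin n × Fin n) ℂ) :=
  fun u t => if t.1 = u ∧ (t.2 : ℕ) = c then 1 else 0
variable (n) in
/-- forget the copy index -/
def fsel : Matrix (St lev r) (Fin m) (MvPolynomial (Fin n × Fin n) ℂ) := fun t u => if t.1 = u then 1 else 0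
variable (n) in
/-- rows with at least `c + 1` copies -/
def psel (c : ℕ) : AffMat n m :=
  Matrix.diagonal fun u => if c < r (lev u) then 1 else 0

end Defs

variable {lev : Fin m → ℕ} {r : ℕ → ℕ}

theorem sum_St_ite (u : Fin m) (c : ℕ) (f : St lev r → MvPolynomial (Fin n × Fin n) ℂ) :
    (∑ t : St lev r, if t.1 = u ∧ (t.2 : ℕ) = c then f t else 0) =
      if h : c < r (lev u) then f ⟨u, ⟨c, h⟩⟩ else 0 := by
  classical
  split_ifs with h
  · rw [Finset.sum_eq_single ⟨u, ⟨c, h⟩⟩]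
    · simp
    · rintro ⟨t1, t2⟩ - ht
      rw [if_neg]
      rintro ⟨h1, h2⟩
      apply ht
      simp only at h1 h2
      subst h1
      simp [Fin.ext_iff, h2]
    · intro h'; exact absurd (Finset.mem_univ _) h'
  · refine Finset.sum_eq_zero fun t _ => ?_
    rw [if_neg]
    rintro ⟨h1, h2⟩
    exact h (h2 ▸ h1 ▸ t.2.isLt)

theorem sum_fin_ite (w₀ : Fin m) (P : Prop) [Decidable P] (f : Fin m → MvPolynomial (Fin n × Fin n) ℂ) :
    (∑ w : Fin m, if w₀ = w ∧ P then f w else 0) = if P then f w₀ else 0 := by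
  classical
  by_cases hP : P
  · simp only [hP, and_true, if_true]
    rw [Finset.sum_ite_eq]; simp
  · simp [hP]

theorem esel_mul_unfN (N : AffMat n m) (c : ℕ) :
    esel n lev r c * unfN lev r N = psel n lev r c * (dgPart lev N * esel n lev r (c + 1) + upPart lev N * esel n lev r 0) := by
  classical
  ext u t
  have hL : (esel n lev r c * unfN lev r N) u t =
      ∑ s : St lev r, if s.1 = u ∧ (s.2 : ℕ) = c then unfN lev r N s t else 0 := by
    rw [Matrix.mul_apply]
    refine Finset.sum_congr rfl fun s _ => ?_
    simp only [esel]; split_ifs <;> simp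
  have hD : (dgPart lev N * esel n lev r (c + 1)) u t = if (t.2 : ℕ) = c + 1 then dgPart lev N u t.1 else 0 := by
    rw [Matrix.mul_apply, ← sum_fin_ite t.1 ((t.2 : ℕ) = c + 1) (fun w => dgPart lev N u w)]
    refine Finset.sum_congr rfl fun w _ => ?_
    simp only [esel]; split_ifs <;> simp_all
  have hU : (upPart lev N * esel n lev r 0) u t = if (t.2 : ℕ) = 0 then upPart lev N u t.1 else 0 := by
    rw [Matrix.mul_apply, ← sum_fin_ite t.1 ((t.2 : ℕ) = 0) (fun w => upPart lev N u w)]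
    refine Finset.sum_congr rfl fun w _ => ?_
    simp only [esel]; split_ifs <;> simp_all
  rw [hL, sum_St_ite, psel, Matrix.diagonal_mul, Matrix.add_apply, hD, hU]
  by_cases h : c < r (lev u)
  · rw [dif_pos h, if_pos h, one_mul]
    simp only [unfN, dgPart, upPart]
    by_cases h0 : (t.2 : ℕ) = 0
    · by_cases hlt : lev u < lev t.1
      · simp [h0, hlt]
      · simp [h0, hlt]
    · by_cases h1 : (t.2 : ℕ) = c + 1
      · by_cases heq : lev u = lev t.1
        · simp [h1, heq]
        · have : ¬ (lev u < lev t.1 ∧ (t.2 : ℕ) = 0) := fun hh => h0 hh.2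
          simp [h1, heq]
      · simp [h0, h1]
  · rw [dif_neg h, if_neg h, zero_mul]

theorem esel_mul_fsel (c : ℕ) : esel n lev r c * fsel n lev r = psel n lev r c := by
  classical
  ext u w
  have hL : (esel n lev r c * fsel n lev r) u w =
      ∑ s : St lev r, if s.1 = u ∧ (s.2 : ℕ) = c then fsel n lev r s w else 0 := by
    rw [Matrix.mul_apply]
    refine Finset.sum_congr rfl fun s _ => ?_
    simp only [esel]; split_ifs <;> simp
  rw [hL, sum_St_ite, psel, Matrix.diagonal_apply]
  by_cases h : c < r (lev u)
  · rw [dif_pos h]; simp only [fsel]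
    by_cases huw : u = w
    · subst huw; simp [h]
    · simp [huw]
  · rw [dif_neg h]
    by_cases huw : u = w
    · subst huw; simp [h]
    · simp [huw]

theorem unfM_eq (M : AffMat n m) : unfM lev r M = fsel n lev r * M * esel n lev r 0 := by
  classical
  ext t s
  have h1 : (fsel n lev r * M) t = fun w => M t.1 w := by
    funext w
    rw [Matrix.mul_apply]
    simp only [fsel]
    rw [show (∑ u : Fin m, (if t.1 = u then (1 : MvPolynomial (Fin n × Fin n) ℂ) else 0) * M u w) = ∑ u : Fin m, (if t.1 = u then M u w else 0) from
      Finset.sum_congr rfl fun u _ => by split_ifs <;> simp]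
    rw [Finset.sum_ite_eq]; simp
  rw [Matrix.mul_apply]
  simp only [h1, esel, unfM]
  rw [show (∑ w : Fin m, M t.1 w * (if s.1 = w ∧ (s.2 : ℕ) = 0 then (1 : MvPolynomial (Fin n × Fin n) ℂ) else 0)) =
      ∑ w : Fin m, (if s.1 = w ∧ (s.2 : ℕ) = 0 then M t.1 w else 0) from
    Finset.sum_congr rfl fun w _ => by split_ifs <;> simp]
  rw [sum_fin_ite]

theorem psel_comm_dgPart (N : AffMat n m) (c : ℕ) :
    Commute (psel n lev r c) (dgPart lev N) := by
  classical
  unfold Commute SemiconjBy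
  ext u w
  rw [psel, Matrix.diagonal_mul, Matrix.mul_diagonal]
  simp only [dgPart]
  by_cases h : lev u = lev w
  · simp [h]
  · simp [h]

theorem psel_mul_psel (c j : ℕ) : psel n lev r c * psel n lev r (c + j) = psel n lev r (c + j) := by
  classical
  rw [psel, psel, Matrix.diagonal_mul_diagonal]
  congr 1
  funext u
  by_cases h : c + j < r (lev u)
  · have h' : c < r (lev u) := by omega
    simp [h, h']
  · simp [h]

theorem diagBlock_pow_ne_zero (N : AffMat n m) (u : Fin m) :
    ∀ (j : ℕ) (v : Fin m), (diagBlock N lev (lev u) ^ j) u v ≠ 0 → lev v = lev u := by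
  classical
  intro j
  induction j with
  | zero =>
      intro v hv
      rw [pow_zero] at hv
      by_cases h : u = v
      · rw [h]
      · exact absurd (Matrix.one_apply_ne h) hv
  | succ j _ =>
      intro v hv
      rw [pow_succ, Matrix.mul_apply] at hv
      obtain ⟨v', -, hv'⟩ := Finset.exists_ne_zero_of_sum_ne_zero hv
      have hB : diagBlock N lev (lev u) v' v ≠ 0 := fun h0 => hv' (by rw [h0, mul_zero])
      simp only [diagBlock] at hB
      by_contra hne
      exact hB (by simp [hne])

theorem dgPart_pow_apply (N : AffMat n m) (u : Fin m) :
    ∀ (j : ℕ) (w : Fin m), (dgPart lev N ^ j) u w = (diagBlock N lev (lev u) ^ j) u w := by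
  classical
  intro j
  induction j with
  | zero => intro w; simp
  | succ j ih =>
      intro w
      rw [pow_succ, pow_succ, Matrix.mul_apply, Matrix.mul_apply]
      refine Finset.sum_congr rfl fun v _ => ?_
      rw [ih v]
      by_cases h0 : (diagBlock N lev (lev u) ^ j) u v = 0
      · rw [h0, zero_mul, zero_mul]
      · have hv : lev v = lev u := diagBlock_pow_ne_zero N u j v h0
        congr 1
        simp only [dgPart, diagBlock, hv, true_and]
        by_cases hw : lev u = lev w
        · simp [hw]
        · have hw' : ¬ lev w = lev u := fun h => hw h.symm
          simp [hw, hw']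

theorem dgPart_pow_apply_eq_zero (N : AffMat n m) (hnil : ∀ l, diagBlock N lev l ^ r l = 0)
    (u w : Fin m) {j : ℕ} (hj : r (lev u) ≤ j) : (dgPart lev N ^ j) u w = 0 := by
  rw [dgPart_pow_apply, ← Nat.add_sub_of_le hj, pow_add, hnil, zero_mul, Matrix.zero_apply]

theorem psel_mul_dgPart_pow (N : AffMat n m) (hnil : ∀ l, diagBlock N lev l ^ r l = 0) (j : ℕ) :
    psel n lev r j * dgPart lev N ^ j = dgPart lev N ^ j := by
  classical
  ext u w
  rw [psel, Matrix.diagonal_mul]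
  by_cases h : j < r (lev u)
  · simp [h]
  · rw [dgPart_pow_apply_eq_zero N hnil u w (not_lt.mp h)]; simp

/-- first-`U` expansion of `(D + U)^d` -/
theorem add_pow_expand (D U : AffMat n m) (d : ℕ) :
    (D + U) ^ d = D ^ d + ∑ j ∈ Finset.range d, D ^ j * U * (D + U) ^ (d - 1 - j) := by
  induction d with
  | zero => simp
  | succ d ih =>
      rw [pow_succ, ih, add_mul, Finset.sum_mul, Finset.sum_range_succ, mul_add, ← pow_succ]
      have hlast : D ^ d * U * (D + U) ^ (d + 1 - 1 - d) = D ^ d * U := by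
        rw [show d + 1 - 1 - d = 0 by omega, pow_zero, mul_one]
      rw [hlast]
      have hsum : ∑ j ∈ Finset.range d, D ^ j * U * (D + U) ^ (d - 1 - j) * (D + U) =
          ∑ j ∈ Finset.range d, D ^ j * U * (D + U) ^ (d + 1 - 1 - j) := by
        refine Finset.sum_congr rfl fun j hj => ?_
        rw [Finset.mem_range] at hj
        rw [mul_assoc, ← pow_succ, show d - 1 - j + 1 = d + 1 - 1 - j by omega]
      rw [hsum]
      abel

/-- the right-hand side of the unfolding invariant -/
def rhs (N : AffMat n m) (d c : ℕ) : AffMat n m :=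
  psel n lev r (c + d) * dgPart lev N ^ d +
    ∑ j ∈ Finset.range d, psel n lev r (c + j) * dgPart lev N ^ j * upPart lev N * N ^ (d - 1 - j)

theorem dgPart_add_upPart (N : AffMat n m) (hup : ∀ u w, lev w < lev u → N u w = 0) :
    dgPart lev N + upPart lev N = N := by
  ext u w
  simp only [Matrix.add_apply, dgPart, upPart]
  rcases lt_trichotomy (lev u) (lev w) with h | h | h
  · simp [h, ne_of_lt h]
  · simp [h]
  · simp [ne_of_gt h, not_lt.mpr (le_of_lt h), hup u w h]

theorem rhs_zero (N : AffMat n m) (hup : ∀ u w, lev w < lev u → N u w = 0)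
    (hnil : ∀ l, diagBlock N lev l ^ r l = 0) (d : ℕ) : rhs (lev := lev) (r := r) N d 0 = N ^ d := by
  rw [rhs, zero_add, psel_mul_dgPart_pow N hnil]
  have hs : ∑ j ∈ Finset.range d, psel n lev r (0 + j) * dgPart lev N ^ j * upPart lev N * N ^ (d - 1 - j) =
      ∑ j ∈ Finset.range d, dgPart lev N ^ j * upPart lev N * (dgPart lev N + upPart lev N) ^ (d - 1 - j) := by
    refine Finset.sum_congr rfl fun j _ => ?_
    rw [zero_add, psel_mul_dgPart_pow N hnil, dgPart_add_upPart N hup]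
  rw [hs, ← add_pow_expand, dgPart_add_upPart N hup]

theorem rhs_succ (N : AffMat n m) (d c : ℕ) :
    psel n lev r c * dgPart lev N * rhs (lev := lev) (r := r) N d (c + 1) + psel n lev r c * upPart lev N * N ^ d =
      rhs (lev := lev) (r := r) N (d + 1) c := by
  set D := dgPart lev N with hD
  set U := upPart lev N with hU
  have hc : ∀ x, D * psel n lev r x = psel n lev r x * D := fun x => ((psel_comm_dgPart N x).eq).symm
  -- head term
  have h1 : psel n lev r c * D * (psel n lev r (c + 1 + d) * D ^ d) = psel n lev r (c + (d + 1)) * D ^ (d + 1) := by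
    calc psel n lev r c * D * (psel n lev r (c + 1 + d) * D ^ d)
        = psel n lev r c * (D * psel n lev r (c + 1 + d)) * D ^ d := by simp only [← mul_assoc]
      _ = psel n lev r c * psel n lev r (c + (d + 1)) * (D * D ^ d) := by
          rw [hc, show c + 1 + d = c + (d + 1) by omega]; simp only [← mul_assoc]
      _ = psel n lev r (c + (d + 1)) * D ^ (d + 1) := by rw [psel_mul_psel, ← pow_succ']
  -- sum terms
  have h2 : ∀ j ∈ Finset.range d, psel n lev r c * D * (psel n lev r (c + 1 + j) * D ^ j * U * N ^ (d - 1 - j)) =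
      psel n lev r (c + (j + 1)) * D ^ (j + 1) * U * N ^ (d + 1 - 1 - (j + 1)) := by
    intro j hj
    rw [Finset.mem_range] at hj
    rw [show d + 1 - 1 - (j + 1) = d - 1 - j by omega, show c + 1 + j = c + (j + 1) by omega]
    calc psel n lev r c * D * (psel n lev r (c + (j + 1)) * D ^ j * U * N ^ (d - 1 - j))
        = psel n lev r c * (D * psel n lev r (c + (j + 1))) * D ^ j * U * N ^ (d - 1 - j) := by
          simp only [← mul_assoc]
      _ = psel n lev r c * psel n lev r (c + (j + 1)) * (D * D ^ j) * U * N ^ (d - 1 - j) := by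
          rw [hc]; simp only [← mul_assoc]
      _ = psel n lev r (c + (j + 1)) * D ^ (j + 1) * U * N ^ (d - 1 - j) := by rw [psel_mul_psel, ← pow_succ']
  have h3 : psel n lev r c * U * N ^ d = psel n lev r (c + 0) * D ^ 0 * U * N ^ (d + 1 - 1 - 0) := by
    rw [add_zero, pow_zero, mul_one, show d + 1 - 1 - 0 = d by omega]
  rw [rhs, rhs, mul_add, Finset.mul_sum, Finset.sum_range_succ' _ d, Finset.sum_congr rfl h2, h1, h3]
  abel

theorem esel_pow_fsel (N : AffMat n m) (hup : ∀ u w, lev w < lev u → N u w = 0)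
    (hnil : ∀ l, diagBlock N lev l ^ r l = 0) :
    ∀ d c, esel n lev r c * unfN lev r N ^ d * fsel n lev r = rhs (lev := lev) (r := r) N d c := by
  intro d
  induction d with
  | zero =>
      intro c
      rw [pow_zero, Matrix.mul_one, esel_mul_fsel, rhs, Finset.range_zero, Finset.sum_empty, add_zero, add_zero,
        pow_zero, Matrix.mul_one]
  | succ d ih =>
      intro c
      have hassoc : esel n lev r c * unfN lev r N ^ (d + 1) * fsel n lev r =
          (esel n lev r c * unfN lev r N) * (unfN lev r N ^ d * fsel n lev r) := by
        rw [pow_succ']; simp only [Matrix.mul_assoc]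
      rw [hassoc, esel_mul_unfN, ← rhs_succ N d c]
      rw [Matrix.mul_add, Matrix.add_mul]
      congr 1
      · calc psel n lev r c * (dgPart lev N * esel n lev r (c + 1)) * (unfN lev r N ^ d * fsel n lev r)
            = psel n lev r c * dgPart lev N * (esel n lev r (c + 1) * unfN lev r N ^ d * fsel n lev r) := by
              simp only [Matrix.mul_assoc]
          _ = psel n lev r c * dgPart lev N * rhs N d (c + 1) := by rw [ih (c + 1)]
      · calc psel n lev r c * (upPart lev N * esel n lev r 0) * (unfN lev r N ^ d * fsel n lev r)
            = psel n lev r c * upPart lev N * (esel n lev r 0 * unfN lev r N ^ d * fsel n lev r) := by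
              simp only [Matrix.mul_assoc]
          _ = psel n lev r c * upPart lev N * N ^ d := by rw [ih 0, rhs_zero N hup hnil]

/-- **THE UNFOLDING IDENTITY.** -/
theorem trace_unfN_pow_mul_unfM (N M : AffMat n m) (hup : ∀ u w, lev w < lev u → N u w = 0)
    (hnil : ∀ l, diagBlock N lev l ^ r l = 0) (d : ℕ) :
    (unfN lev r N ^ d * unfM lev r M).trace = (N ^ d * M).trace := by
  rw [unfM_eq]
  calc (unfN lev r N ^ d * (fsel n lev r * M * esel n lev r 0)).trace
      = ((unfN lev r N ^ d * fsel n lev r * M) * esel n lev r 0).trace := by simp only [Matrix.mul_assoc]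
    _ = (esel n lev r 0 * (unfN lev r N ^ d * fsel n lev r * M)).trace := Matrix.trace_mul_comm _ _
    _ = ((esel n lev r 0 * unfN lev r N ^ d * fsel n lev r) * M).trace := by simp only [Matrix.mul_assoc]
    _ = (N ^ d * M).trace := by rw [esel_pow_fsel N hup hnil d 0, rhs_zero N hup hnil]

end UnfoldCore

/-- **U1 PROVED.**  The unfolded pencil, re-indexed along an order-preserving enumeration of the states `(u, c)`
(sorted by `(lev u, c, u)`), is affine, strictly upper triangular, of width `indexMass lev r = Σ_u r(lev u)`, and has
the same `tr(N'^d M')`. [folklore] -/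
theorem unfolding_proof : Unfolding := by
  intro n m d N M lev r hN hM hup hnil
  classical
  -- enumerate the states along the key `(lev u, c, u)` (lexicographic), WITHOUT putting an order instance on `St`
  let φ : St lev r → ℕ ×ₗ (ℕ ×ₗ ℕ) := fun s => toLex (lev s.1, toLex ((s.2 : ℕ), (s.1 : ℕ)))
  have hφ : Function.Injective φ := by
    rintro ⟨u, c⟩ ⟨u', c'⟩ h
    simp only [φ, toLex_inj, Prod.mk.injEq] at h
    obtain ⟨-, hc, hu⟩ := h
    have hu' : u = u' := Fin.ext hu
    subst hu'
    have hc' : c = c' := Fin.ext hc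
    subst hc'
    rfl
  have hcard : (Finset.univ : Finset (St lev r)).card = indexMass lev r := by
    rw [Finset.card_univ, indexMass]
    simp [St, Fintype.card_sigma]
  let T : Finset (ℕ ×ₗ (ℕ ×ₗ ℕ)) := Finset.univ.image φ
  have hT : T.card = indexMass lev r := by
    rw [Finset.card_image_of_injective _ hφ, hcard]
  let ω := T.orderEmbOfFin hT
  have hmem : ∀ i : Fin (indexMass lev r), ∃ s : St lev r, φ s = ω i := by
    intro i
    have hi : ω i ∈ T := T.orderEmbOfFin_mem hT i
    obtain ⟨s, -, hs⟩ := Finset.mem_image.mp hi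
    exact ⟨s, hs⟩
  choose g hg using hmem
  have hginj : Function.Injective g := by
    intro i j h
    apply ω.injective
    rw [← hg, ← hg, h]
  have hbij : Function.Bijective g := by
    rw [Fintype.bijective_iff_injective_and_card]
    refine ⟨hginj, ?_⟩
    rw [Fintype.card_fin, ← Finset.card_univ, hcard]
  let e : Fin (indexMass lev r) ≃ St lev r := Equiv.ofBijective g hbij
  have he : ∀ i, e i = g i := fun i => rfl
  refine ⟨(unfN lev r N).submatrix e e, (unfM lev r M).submatrix e e, ?_, ?_, ?_, ?_⟩
  · intro i j
    simp only [Matrix.submatrix_apply, unfN]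
    split_ifs
    · exact hN _ _
    · rw [totalDegree_zero]; exact Nat.zero_le _
  · intro i j
    simp only [Matrix.submatrix_apply, unfM]
    split_ifs
    · exact hM _ _
    · rw [totalDegree_zero]; exact Nat.zero_le _
  · intro i j hji
    simp only [Matrix.submatrix_apply, unfN]
    rw [if_neg]
    intro hcond
    have hlt : φ (e i) < φ (e j) := by
      rcases hcond with ⟨h1, h2⟩ | ⟨h1, h2⟩
      · simp only [φ, Prod.Lex.toLex_lt_toLex, h1, lt_self_iff_false, true_and, false_or]
        left; omega
      · simp only [φ, Prod.Lex.toLex_lt_toLex]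
        left; exact h1
    rw [he, he, hg, hg, ω.lt_iff_lt] at hlt
    exact absurd hlt (not_lt.mpr hji)
  · have htr : ∀ (A : Matrix (St lev r) (St lev r) (MvPolynomial (Fin n × Fin n) ℂ)),
        (A.submatrix e e).trace = A.trace := by
      intro A
      simp only [Matrix.trace, Matrix.diag_apply, Matrix.submatrix_apply]
      exact e.sum_comp (fun s => A s s)
    have hre : ((unfN lev r N).submatrix e e) ^ d * (unfM lev r M).submatrix e e =
        (unfN lev r N ^ d * unfM lev r M).submatrix e e := by
      have h1 : ((unfN lev r N).submatrix e e) ^ d = (unfN lev r N ^ d).submatrix e e := by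
        induction d with
        | zero => rw [pow_zero, pow_zero, Matrix.submatrix_one_equiv]
        | succ d ih => rw [pow_succ, pow_succ, ih, Matrix.submatrix_mul_equiv]
      rw [h1, Matrix.submatrix_mul_equiv]
    rw [hre, htr, trace_unfN_pow_mul_unfM N M hup hnil d]

/-! ## Kernel-checked composition -/

/-- Arithmetic of the landed rung: a strictly upper triangular representation of width `m'` forces
`n³ ≤ 144·m'²` (`q := ⌊√n⌋` in `sq_le_of_trace_pow_mul_strictUpper'`). [folklore] -/
theorem cube_le_of_strictUpperRepr {n m' : ℕ} (hn : 4 ≤ n) (h : StrictUpperRepr n m') :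
    n ^ 3 ≤ 144 * m' ^ 2 := by
  obtain ⟨N, M, hN, hM, htri, hper⟩ := h
  set s := Nat.sqrt n with hs
  have hs1 : s ^ 2 ≤ n := Nat.sqrt_le' n
  have hs2 : n < (s + 1) ^ 2 := Nat.lt_succ_sqrt' n
  have hs0 : 1 ≤ s := Nat.succ_le_of_lt (Nat.sqrt_pos.2 (by omega))
  have hrung := sq_le_of_trace_pow_mul_strictUpper' N M hN hM htri hper hs0
  -- `s·n² ≤ 2n(m'+s) + m'·s² ≤ n·(3m' + 2s)`
  have h1 : s * n ^ 2 ≤ n * (3 * m' + 2 * s) := by nlinarith [hrung, hs1]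
  have hn0 : 0 < n := by omega
  have h2 : s * n ≤ 3 * m' + 2 * s := by
    have h1' : n * (s * n) ≤ n * (3 * m' + 2 * s) := by nlinarith [h1]
    exact Nat.le_of_mul_le_mul_left h1' hn0
  -- `n ≥ 4`: `2s ≤ s·n/2`, so `s·n ≤ 6m'`
  have h3 : s * n ≤ 6 * m' := by nlinarith [h2, hn, Nat.mul_le_mul_left s hn]
  have h4 : (s * n) * (s * n) ≤ (6 * m') * (6 * m') := Nat.mul_le_mul h3 h3
  -- `n < (s+1)² ≤ 4s²`
  have hs3 : n ≤ 4 * s ^ 2 := by nlinarith [hs2, hs0]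
  have h5 : n * n ^ 2 ≤ (4 * s ^ 2) * n ^ 2 := Nat.mul_le_mul_right (n ^ 2) hs3
  nlinarith [h4, h5]

/-- **The deciding chain of the line:** `Unfolding → CheapIndexMass → DualUnipotentThreeHalves` (target decl BY NAME;
the hypothesis of the target is definitionally `DualUnipotentRepr n m`). -/
theorem dualUnipotentThreeHalves_of (hU1 : Unfolding) (hU2 : CheapIndexMass) : DualUnipotentThreeHalves := by
  obtain ⟨C, n₀, hC⟩ := hU2
  refine ⟨144 * C ^ 2, max n₀ 4, ?_⟩
  intro n hn m hrep
  have hn₀ : n₀ ≤ n := le_trans (le_max_left _ _) hn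
  have hn4 : 4 ≤ n := le_trans (le_max_right _ _) hn
  have hrep' : DualUnipotentRepr n m := hrep
  obtain ⟨N, M, lev, r, ⟨hN, hM, hper, hup, hnil⟩, hmass⟩ := hC n hn₀ m hrep'
  obtain ⟨N', M', hN', hM', htri, htr⟩ := hU1 n m (n - 1) N M lev r hN hM hup hnil
  have hSU : StrictUpperRepr n (indexMass lev r) := ⟨N', M', hN', hM', htri, hper.trans htr.symm⟩
  have hcube := cube_le_of_strictUpperRepr hn4 hSU
  have hsq : indexMass lev r ^ 2 ≤ (C * m) ^ 2 := Nat.pow_le_pow_left hmass 2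
  nlinarith [hcube, hsq]

/-- The target through U1 (PROVED) and the one open stub `stub_cheapIndexMass` (the crux). -/
theorem dualUnipotentThreeHalves_via_stubs : DualUnipotentThreeHalves :=
  dualUnipotentThreeHalves_of unfolding_proof stub_cheapIndexMass

/-- **Crux-only composition (v2).**  With U1 proved, the line is ONE implication from its per-specific crux. -/
theorem dualUnipotentThreeHalves_of_cheapIndexMass (hU2 : CheapIndexMass) : DualUnipotentThreeHalves :=
  dualUnipotentThreeHalves_of unfolding_proof hU2

/-! ## Sanity: the triangularisable class has index mass `m` (U2 with `C = 1` there) -/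

/-- A strictly upper triangular `N` is in block form for `lev = id` with every constituent ZERO (`r ≡ 1`), and the
index mass is the width: U2 generalises the triangularisable rung. [folklore] -/
theorem blockRepr_of_strictUpper {n m : ℕ} (N M : AffMat n m) (hN : IsAffine N) (hM : IsAffine M)
    (htri : ∀ i j : Fin m, j ≤ i → N i j = 0) (hper : perPoly (Fin n) ℂ = (N ^ (n - 1) * M).trace) :
    BlockRepr n m N M (fun u => u.val) (fun _ => 1) ∧ indexMass (fun u : Fin m => u.val) (fun _ => 1) = m := by
  refine ⟨⟨hN, hM, hper, ?_, ?_⟩, ?_⟩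
  · intro i j hij
    exact htri i j (le_of_lt (Fin.lt_def.2 hij))
  · intro l
    rw [pow_one]
    refine Matrix.ext (fun i j => ?_)
    simp only [diagBlock, Matrix.zero_apply]
    split_ifs with h
    · exact htri i j (le_of_eq (Fin.ext (h.2.trans h.1.symm)))
    · rfl
  · simp [indexMass]

end Summit.ValiantsHypothesis.ValiantsHypothesis.Cruxes.DualUnipotentThreeHalves.WildUnfold

namespace Summit.ValiantsHypothesis.ValiantsHypothesis.Cruxes.DualUnipotentThreeHalves.WildMass

open MvPolynomial Matrix
open scoped BigOperators
open Literature.Computability.AlgebraicComplexity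
open Summit.ValiantsHypothesis.ValiantsHypothesis.Cruxes.TwoDimCoefficients.DimTwoCases
  (AffMat IsAffine DualUnipotentRepr foldr_mkDerivation_eq_zero_of_totalDegree_le totalDegree_aeval_line_le_one
    aeval_line_of_totalDegree_le_one finrank_le_of_iterD_perPoly_eq_zero)
open Summit.ValiantsHypothesis.ValiantsHypothesis.Theses.GrenetZeon (DualUnipotentThreeHalves)

/-! ## Block data -/

/-- `N` is block-upper-triangular for the level function `lev` (entry `i → j` vanishes unless `lev i ≤ lev j`). -/
def IsBlockUpper {n m : ℕ} (N : AffMat n m) (lev : Fin m → ℕ) : Prop :=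
  ∀ i j : Fin m, lev j < lev i → N i j = 0

/-- The linear coefficient of entry `(i, j)` of the pencil in direction `v`: `Σ_c v_c · [x_c](N i j)`. -/
def linCoeff {n m : ℕ} (N : AffMat n m) (v : Fin n × Fin n → ℂ) (i j : Fin m) : ℂ :=
  ∑ c, v c * coeff (Finsupp.single c 1) (N i j)

/-- `K` is a space of directions along which the DIAGONAL constituents of the block form do not move. -/
def DiagStill {n m : ℕ} (N : AffMat n m) (lev : Fin m → ℕ) (K : Submodule ℂ (Fin n × Fin n → ℂ)) : Prop :=
  ∀ v ∈ K, ∀ i j : Fin m, lev i = lev j → linCoeff N v i j = 0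

/-! ## The two statements (F1 proved below, F2 = the open stub) -/

/-- **F1 — LEVEL FLATNESS (PROVED: `levelFlat_proof`; p593700's proof with an arbitrary level function).**  If `per_n = tr(N^d·M)`
with `N, M` affine, `N` block-upper for a level function with `< g` levels, and the diagonal constituents are still along
`K`, then along every coset of `K` the pencil is block-graded, `tr(N^d M)` has degree `≤ g`, all `(g+1)`-st derivatives
of `per_n` along `K` vanish, and LEMMA_g (`finrank_le_of_iterD_perPoly_eq_zero`) gives `dim K ≤ 2gn`. -/
def LevelFlat : Prop :=
  ∀ (n m d g : ℕ) (N M : AffMat n m) (lev : Fin m → ℕ) (K : Submodule ℂ (Fin n × Fin n → ℂ)),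
    IsAffine N → IsAffine M → IsBlockUpper N lev → (∀ u : Fin m, lev u < g) →
      perPoly (Fin n) ℂ = (N ^ d * M).trace → DiagStill N lev K → Module.finrank ℂ K ≤ 2 * g * n

/-- **F2 — CHEAP PARAMETER MASS (the crux of the line; per-specific; the typed obstruction).**  Every unipotent dual
representation of `per_n` of width `m` can be replaced by one of the same width with a block form of `O(m/√n + 1)` levels
whose diagonal constituents move only in codimension `O(m·√n)`.  Negation = the portrait: in every block form of every
width-`m` representation of a counterexample family, the diagonal (wild) constituents carry `(1 − o(1))·n²` parameters. -/
def CheapParameterMass : Prop :=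
  ∃ C n₀ : ℕ, ∀ n ≥ n₀, ∀ m : ℕ, DualUnipotentRepr n m →
    ∃ (N M : AffMat n m) (lev : Fin m → ℕ) (g : ℕ) (K : Submodule ℂ (Fin n × Fin n → ℂ)),
      IsAffine N ∧ IsAffine M ∧ perPoly (Fin n) ℂ = (N ^ (n - 1) * M).trace ∧ IsBlockUpper N lev ∧
        (∀ u : Fin m, lev u < g) ∧ DiagStill N lev K ∧
        g * Nat.sqrt n ≤ C * (m + Nat.sqrt n) ∧ n ^ 2 ≤ Module.finrank ℂ K + C * m * Nat.sqrt n

theorem stub_cheapParameterMass : CheapParameterMass := by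
  sorry

/-! ## F1 PROVED — block grading for an arbitrary level function (p593700's argument verbatim with `lev`) -/
section LevelFlatProof

variable {m k : ℕ}

/-- Products of level-graded matrices (degree + lev(row) ≤ lev(col) on non-zero entries) are level-graded. [folklore] -/
theorem levGraded_mul (lev : Fin m → ℕ) (Y Z : Matrix (Fin m) (Fin m) (MvPolynomial (Fin (k + 1)) ℂ))
    (hY : ∀ i j, Y i j ≠ 0 → (Y i j).totalDegree + lev i ≤ lev j)
    (hZ : ∀ i j, Z i j ≠ 0 → (Z i j).totalDegree + lev i ≤ lev j) :
    ∀ i j, (Y * Z) i j ≠ 0 → ((Y * Z) i j).totalDegree + lev i ≤ lev j := by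
  intro i j hij
  rw [Matrix.mul_apply] at hij ⊢
  obtain ⟨l, -, hl⟩ := Finset.exists_ne_zero_of_sum_ne_zero hij
  have hYl : Y i l ≠ 0 := fun h => hl (by rw [h, zero_mul])
  have hZl : Z l j ≠ 0 := fun h => hl (by rw [h, mul_zero])
  have hblock : lev i ≤ lev j :=
    ((Nat.le_add_left _ _).trans (hY i l hYl)).trans ((Nat.le_add_left _ _).trans (hZ l j hZl))
  have hterm : ∀ l', (Y i l' * Z l' j).totalDegree + lev i ≤ lev j := by
    intro l'
    by_cases h0 : Y i l' * Z l' j = 0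
    · rw [h0, totalDegree_zero, zero_add]; exact hblock
    · have h1 := hY i l' (fun h => h0 (by rw [h, zero_mul]))
      have h2 := hZ l' j (fun h => h0 (by rw [h, mul_zero]))
      have h3 := totalDegree_mul (Y i l') (Z l' j)
      omega
  have hsum := totalDegree_finsetSum Finset.univ (fun l' => Y i l' * Z l' j)
  have hsup : (Finset.univ.sup fun l' => (Y i l' * Z l' j).totalDegree) + lev i ≤ lev j := by
    have : Finset.univ.sup (fun l' => (Y i l' * Z l' j).totalDegree) ≤ lev j - lev i :=
      Finset.sup_le fun l' _ => by have := hterm l'; omega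
    omega
  omega

/-- Powers of a level-graded matrix are level-graded. [folklore] -/
theorem levGraded_pow (lev : Fin m → ℕ) (Y : Matrix (Fin m) (Fin m) (MvPolynomial (Fin (k + 1)) ℂ))
    (hY : ∀ i j, Y i j ≠ 0 → (Y i j).totalDegree + lev i ≤ lev j) (d : ℕ) :
    ∀ i j, (Y ^ d) i j ≠ 0 → ((Y ^ d) i j).totalDegree + lev i ≤ lev j := by
  induction d with
  | zero =>
      intro i j hij
      rw [pow_zero] at hij ⊢
      by_cases h : i = j
      · subst h; rw [Matrix.one_apply_eq, totalDegree_one, zero_add]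
      · exact absurd (Matrix.one_apply_ne h) hij
  | succ d ih =>
      rw [pow_succ]
      exact levGraded_mul lev _ _ ih hY

/-- Level grading of the pulled-back pencil: `N` affine and block-upper for `lev`, directions killing the same-level linear
coefficients ⇒ entry `(i, j)` of the pull-back has `s`-degree `≤ lev j − lev i`. [folklore] -/
theorem levGraded_aeval_line {n : ℕ} (lev : Fin m → ℕ) (N : AffMat n m) (hN : IsAffine N) (hup : IsBlockUpper N lev)
    (x : Fin n × Fin n → ℂ) (v : Fin (k + 1) → (Fin n × Fin n → ℂ))
    (hv : ∀ t (i j : Fin m), lev i = lev j → ∑ c, v t c * coeff (Finsupp.single c 1) (N i j) = 0) :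
    ∀ i j, (N.map (aeval (fun c => (C (x c) + ∑ t, C (v t c) * X t : MvPolynomial (Fin (k + 1)) ℂ))))
        i j ≠ 0 →
      ((N.map (aeval (fun c => (C (x c) + ∑ t, C (v t c) * X t : MvPolynomial (Fin (k + 1)) ℂ))))
        i j).totalDegree + lev i ≤ lev j := by
  intro i j hij
  rw [Matrix.map_apply] at hij ⊢
  have hle : lev i ≤ lev j := by
    by_contra h
    exact hij (by rw [hup i j (not_le.mp h), map_zero])
  by_cases heq : lev i = lev j
  · rw [aeval_line_of_totalDegree_le_one x v (hN i j)]
    simp only [hv _ i j heq, map_zero, zero_mul, Finset.sum_const_zero, add_zero, totalDegree_C,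
      zero_add]
    exact hle
  · have h1 := totalDegree_aeval_line_le_one x v (hN i j)
    omega

/-- Degree of the pulled-back trace product for a `g`-level block form: `≤ g`. [folklore] -/
theorem totalDegree_aeval_line_trace_le_lev {n d g : ℕ} (lev : Fin m → ℕ) (N M : AffMat n m)
    (hN : IsAffine N) (hM : IsAffine M) (hup : IsBlockUpper N lev) (hg : ∀ u : Fin m, lev u < g)
    (x : Fin n × Fin n → ℂ) (v : Fin (g + 1) → (Fin n × Fin n → ℂ))
    (hv : ∀ t (i j : Fin m), lev i = lev j → ∑ c, v t c * coeff (Finsupp.single c 1) (N i j) = 0) :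
    (aeval (fun c => (C (x c) + ∑ t, C (v t c) * X t : MvPolynomial (Fin (g + 1)) ℂ))
      ((N ^ d * M).trace)).totalDegree ≤ g := by
  set θ : Fin n × Fin n → MvPolynomial (Fin (g + 1)) ℂ := fun c => C (x c) + ∑ t, C (v t c) * X t
    with hθ
  have hmap : aeval θ ((N ^ d * M).trace) = ((N.map (aeval θ)) ^ d * M.map (aeval θ)).trace := by
    rw [show N.map (aeval θ) = (aeval θ).toRingHom.mapMatrix N from rfl,
      show M.map (aeval θ) = (aeval θ).toRingHom.mapMatrix M from rfl, ← map_pow, ← map_mul]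
    simp only [Matrix.trace, Matrix.diag_apply, map_sum, RingHom.mapMatrix_apply, Matrix.map_apply]
    rfl
  rw [hmap, Matrix.trace]
  simp only [Matrix.diag_apply, Matrix.mul_apply]
  have hgr := levGraded_pow lev (N.map (aeval θ)) (levGraded_aeval_line lev N hN hup x v hv) d
  have hbound : ∀ i j : Fin m, ((N.map (aeval θ) ^ d) i j * (M.map (aeval θ)) j i).totalDegree ≤ g := by
    intro i j
    by_cases h0 : (N.map (aeval θ) ^ d) i j = 0
    · rw [h0, zero_mul, totalDegree_zero]; exact Nat.zero_le _
    · have h1 := hgr i j h0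
      have h2 : ((M.map (aeval θ)) j i).totalDegree ≤ 1 := by
        rw [Matrix.map_apply]; exact totalDegree_aeval_line_le_one x v (hM j i)
      have h3 := totalDegree_mul ((N.map (aeval θ) ^ d) i j) ((M.map (aeval θ)) j i)
      have hj : lev j + 1 ≤ g := hg j
      omega
  refine (totalDegree_finsetSum _ _).trans (Finset.sup_le fun i _ => ?_)
  exact (totalDegree_finsetSum _ _).trans (Finset.sup_le fun j _ => hbound i j)

end LevelFlatProof

/-- **F1 PROVED.** Level flatness: `dim K ≤ 2·g·n` (block grading along `K`-cosets + LEMMA_g, p593106). [folklore] -/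
theorem levelFlat_proof : LevelFlat := by
  intro n m d g N M lev K hN hM hup hg hper hK
  classical
  have hflat : ∀ dv : Fin (g + 1) → (Fin n × Fin n → ℂ), (∀ t, dv t ∈ K) →
      (List.ofFn dv).foldr
        (fun u f => mkDerivation ℂ (fun c => (C (u c) : MvPolynomial (Fin n × Fin n) ℂ)) f)
        (perPoly (Fin n) ℂ) = 0 := by
    intro dv hdv
    refine foldr_mkDerivation_eq_zero_of_totalDegree_le K _ (fun x v hv => ?_) dv hdv
    rw [hper]
    exact totalDegree_aeval_line_trace_le_lev lev N M hN hM hup hg x v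
      (fun t i j hij => hK (v t) (hv t) i j hij)
  have h := finrank_le_of_iterD_perPoly_eq_zero K hflat
  calc Module.finrank ℂ K ≤ g * (2 * n) := h
    _ = 2 * g * n := by ring

/-! ## Kernel-checked composition -/

/-- **The deciding chain of the line:** `LevelFlat → CheapParameterMass → DualUnipotentThreeHalves` (target decl BY NAME;
the hypothesis of the target is definitionally `DualUnipotentRepr n m`).  Arithmetic: `s := ⌊√n⌋`,
`n² ≤ 2gn + C·m·s`, `g·s ≤ C(m+s)` ⇒ `s·n ≤ 3Cm + 2Cs` ⇒ (`n ≥ 4C`) `s·n ≤ 6Cm` ⇒ `n³ ≤ 4s²n² ≤ 144·C²·m²`. -/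
theorem dualUnipotentThreeHalves_of (hF1 : LevelFlat) (hF2 : CheapParameterMass) : DualUnipotentThreeHalves := by
  obtain ⟨C, n₀, hC⟩ := hF2
  refine ⟨144 * C ^ 2, max n₀ (max 4 (4 * C)), ?_⟩
  intro n hn m hrep
  have hn₀ : n₀ ≤ n := le_trans (le_max_left _ _) hn
  have hn4 : 4 ≤ n := le_trans (le_trans (le_max_left _ _) (le_max_right _ _)) hn
  have hnC : 4 * C ≤ n := le_trans (le_trans (le_max_right _ _) (le_max_right _ _)) hn
  have hrep' : DualUnipotentRepr n m := hrep
  obtain ⟨N, M, lev, g, K, hN, hM, hper, hup, hg, hK, hgs, hmass⟩ := hC n hn₀ m hrep'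
  have hdim : Module.finrank ℂ K ≤ 2 * g * n := hF1 n m (n - 1) g N M lev K hN hM hup hg hper hK
  set s := Nat.sqrt n with hs
  have hs1 : s ^ 2 ≤ n := Nat.sqrt_le' n
  have hs2 : n < (s + 1) ^ 2 := Nat.lt_succ_sqrt' n
  have hs0 : 1 ≤ s := Nat.succ_le_of_lt (Nat.sqrt_pos.2 (by omega))
  have hn0 : 0 < n := by omega
  -- `n² ≤ 2gn + C m s`
  have h0 : n ^ 2 ≤ 2 * g * n + C * m * s := le_trans hmass (Nat.add_le_add_right hdim _)
  -- multiply by `s`, use `g s ≤ C(m+s)` and `s² ≤ n`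
  have h1 : s * n ^ 2 ≤ n * (3 * C * m + 2 * C * s) := by
    have e1 : s * n ^ 2 ≤ s * (2 * g * n + C * m * s) := Nat.mul_le_mul_left s h0
    have e2 : 2 * (g * s) * n ≤ 2 * (C * (m + s)) * n :=
      Nat.mul_le_mul_right n (Nat.mul_le_mul_left 2 hgs)
    have e3 : C * m * (s * s) ≤ C * m * n := Nat.mul_le_mul_left (C * m) (by nlinarith [hs1])
    nlinarith [e1, e2, e3]
  have h2 : s * n ≤ 3 * C * m + 2 * C * s := by
    have h1' : n * (s * n) ≤ n * (3 * C * m + 2 * C * s) := by nlinarith [h1]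
    exact Nat.le_of_mul_le_mul_left h1' hn0
  -- `n ≥ 4C`: `2Cs·2 ≤ s n`, so `s n ≤ 6 C m`
  have h3 : s * n ≤ 6 * C * m := by nlinarith [h2, hnC, Nat.mul_le_mul_left s hnC]
  have h4 : (s * n) * (s * n) ≤ (6 * C * m) * (6 * C * m) := Nat.mul_le_mul h3 h3
  have hs3 : n ≤ 4 * s ^ 2 := by nlinarith [hs2, hs0]
  have h5 : n * n ^ 2 ≤ (4 * s ^ 2) * n ^ 2 := Nat.mul_le_mul_right (n ^ 2) hs3
  nlinarith [h4, h5]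

/-- The target through F1 (PROVED) and the one open stub `stub_cheapParameterMass` (the crux). -/
theorem dualUnipotentThreeHalves_via_stubs : DualUnipotentThreeHalves :=
  dualUnipotentThreeHalves_of levelFlat_proof stub_cheapParameterMass

/-! ## Sanity: the profile-barrier / triangularisable shape satisfies F2's block conditions -/

/-- For a STRICTLY upper triangular `N`, the identity level function is a block form, and the whole direction space is
«diagonal-still» (the constituents are zero): F2 then asks only `m ≤ C(m + √n)·…`-type arithmetic — with `lev = id` it records only
the block shape; F2's witness for a triangularisable pencil uses `⌈√n⌉`-blocks of the flag (mass `≤ m√n/2`). [folklore] -/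
theorem diagStill_top_of_strictUpper {n m : ℕ} (N : AffMat n m) (htri : ∀ i j : Fin m, j ≤ i → N i j = 0) :
    IsBlockUpper N (fun u => u.val) ∧ DiagStill N (fun u => u.val) ⊤ := by
  refine ⟨fun i j hij => htri i j (le_of_lt (Fin.lt_def.2 hij)), ?_⟩
  intro v _ i j hij
  have hz : N i j = 0 := htri i j (le_of_eq (Fin.ext hij.symm))
  simp [linCoeff, hz]

end Summit.ValiantsHypothesis.ValiantsHypothesis.Cruxes.DualUnipotentThreeHalves.WildMass

/-! ## The joint composition (one line, two heads) -/

namespace Summit.ValiantsHypothesis.ValiantsHypothesis.Cruxes.DualUnipotentThreeHalves.WildPortrait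

open Summit.ValiantsHypothesis.ValiantsHypothesis.Cruxes.DualUnipotentThreeHalves
open Summit.ValiantsHypothesis.ValiantsHypothesis.Theses.GrenetZeon (DualUnipotentThreeHalves)

/-- **ONE LINE, TWO HEADS.**  Either per-specific crux closes the 3/2 rung BY NAME (U1 and F1 are proved above). -/
theorem dualUnipotentThreeHalves_of_either (h : WildUnfold.CheapIndexMass ∨ WildMass.CheapParameterMass) :
    DualUnipotentThreeHalves :=
  h.elim WildUnfold.dualUnipotentThreeHalves_of_cheapIndexMass
    (fun hF2 => WildMass.dualUnipotentThreeHalves_of WildMass.levelFlat_proof hF2)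

/-- The target through the two open stubs (sorry-dependent exactly through `WildUnfold.stub_cheapIndexMass`; the `F2` head
is `WildMass.dualUnipotentThreeHalves_via_stubs`). -/
theorem dualUnipotentThreeHalves_via_stubs : DualUnipotentThreeHalves :=
  dualUnipotentThreeHalves_of_either (Or.inl WildUnfold.stub_cheapIndexMass)

end Summit.ValiantsHypothesis.ValiantsHypothesis.Cruxes.DualUnipotentThreeHalves.WildPortrait

end
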